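/-
Copyright: the b2b-balaban T⁴-continuum CRUX team, row NE7b OWNER lineage `t4-ne7b-p1` (gen 140). Project licence.
-/
import Summits.QuantumFields.BalabanUV.T4Continuum.Spine.NE7b.SupWhitenedPoincareLetters

/-!
# THE FOURTH CENTRED MOMENT OF A GRADIENT COMPONENT UNDER `N(0,AAᵀ)` — the letter `m₄` of the third-cumulant bound (SCOPING (d11)(4)):
# Poincaré ((464), in whitened coordinates) applied once more to `(g_v − μ)²`, `g_v(ξ) = U′(Aξ+ψ)(e_v)`, `μ` its tilted mean, gives
#   `E_ν̃(g_v − μ)⁴ ≤ 5κ₂⁴γ_op²∕(1 − λγ_op)²`   UNIFORMLY in the background `ψ`, the site `v` and the volume,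
# for the block class (`‖U″‖ ≤ κ₂`, secant letter `λ ≥ 0`, stability∕gradient letters, the regulator) and ANY factor `A` of the fluctuation
# covariance with the operator letter `(γ_op·1 − AAᵀ) ⪰ 0` and `λγ_op < 1` — and, read through (457)'s bridge, the same bound in (461)'s Gibbs
# format `ν ∝ e^{−V}dz` on `ℝ^κ` together with the integrability of the fourth centred power: the hypotheses `hF4, hmF` of (461)
# `third_cumulant_le` DISCHARGED (row NE7b, node U5c; (422), (423), (457), (464) BY NAME; [folklore] + [cite: BrascampLieb1976, Thm 4.1]
# through (422))

Cell `pub-balaban`, sub-cell `t4`, spine estimate NE7b (`T4WeightBudget.RelWeightBound`; the cell's OWN estimate — NOT PRINTED in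
[Bałaban 1983–89], NOT PROVED).  Crux-route work under `Spine/NE7b/` by the row OWNER (`t4-ne7b-p1` gen 140, file (465)) under FREEZE
(0)'s crux-prover clause; NOTHING of Bałaban's is named as a Lean object, valued or asserted; no `T4Continuum/Support` leaf typed; no
`def`, no notation; zero `sorry`.  Imports (BY NAME): the OWNER's (464) `…SupWhitenedPoincareLetters` (`whitened_variance_le`,
`whitened_obs_hasFDerivAt`, `whitened_obs_moments`, `whitened_secant`, `one_floor`, `op_letter_nonneg`; through it (422) `tilted_poincare`,
(458) `whitened_exp_integrable`, (457) `whitened_tilted_eq_gauss`, `whitened_integrable_lebesgue`, (456) `whitened_hasFDerivAt`).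

WHAT IS PROVED ([folklore]):
* §1 THE END in whitened coordinates **`whitened_fourth_moment_le`** (`Z⁻¹∫e^{−U(Tξ+ψ)}(g_v − μ)⁴dN(0,I) ≤ 5κ₂⁴γ_op²∕(1−λγ_op)²`; the
  variance identity `Z⁻¹∫e(g − μ)² = Z⁻¹∫eg² − μ²` and the integrability of the centred pieces inline, as in (423)).
* §2 (461)'s format: **`whitened_fourth_moment_gibbs`** (`∫(F_v − E_νF_v)⁴dν ≤ 5κ₂⁴γ_op²∕(1−λγ_op)²`, `F_v(z) = U′(T toLp z + ψ)(e_v)`) and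
  **`whitened_fourth_power_integrable`** (`(F_v − c)⁴ ∈ L¹(ν)` for every constant `c`).

HONEST (what this is NOT).  A moment letter; the third-order kernel letter's assembly (the cumulant form of `∂³W` for a general `Γ = AAᵀ`,
(461)+(462)+(463) instantiated with these moments and the weighted letters of the whitened Dobrushin matrix) is the successor's; orders four
and five are NOT typed.  Scalar skeleton ((A3), NC-NE7b-α UNRULED); nothing of Bałaban's asserted.  BY-NAME EFFECT ON THE WALL: NONE.  NE7b
NOT PRINTED ∕ NOT PROVED; spine PROVED 0∕9; rung (B)+1 — the programme's measures remain FINITE-torus statements; NOT the mass gap, NOT Clay.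
HONEST DEPENDENCY: continuum YM on T⁴ ⇐ BetaPertH ∧ nine spine estimates (0∕9 proved); BetaPertH ⇐ (D1) ∧ (D4) ∧ CAP+tail; G-an2-4 gates
asym, D1 and NE2∕3∕4.
-/

set_option autoImplicit false
set_option maxSynthPendingDepth 2

noncomputable section

namespace Summit.QuantumFields.BalabanUV.T4Continuum.NE7b.SupWhitenedFourthMoment

open MeasureTheory ProbabilityTheory Real Set Function Finset Matrix
open scoped BigOperators
open Literature.Probability.Distributions (matrixCLM)
open SupWhitenedPoincareLetters (whitened_variance_le whitened_obs_hasFDerivAt whitened_obs_moments whitened_secant one_floor)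
open SupWhitenedMomentLetters (op_letter_nonneg whitened_exp_integrable)
open SupWhitenedCovarianceKernelLetter (whitened_tilted_eq_gauss whitened_integrable_lebesgue)
open SupWhitenedFirstOrderLetters (whitened_hasFDerivAt)
open SupTiltedPoincare (tilted_poincare)

variable {ι κ : Type} [Fintype ι] [DecidableEq ι] [Fintype κ] [DecidableEq κ]

variable {U : EuclideanSpace ℝ ι → ℝ} {U' : EuclideanSpace ℝ ι → EuclideanSpace ℝ ι →L[ℝ] ℝ}
  {U'' : EuclideanSpace ℝ ι → EuclideanSpace ℝ ι →L[ℝ] EuclideanSpace ℝ ι →L[ℝ] ℝ} {A : Matrix ι κ ℝ}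
  {ψ : EuclideanSpace ℝ ι} {γop κ₀ κ₁ κ₂ a τ δ θ lam : ℝ}

/-! ## §1. The fourth centred moment in whitened coordinates -/

/-- **THE FOURTH CENTRED MOMENT IN WHITENED COORDINATES**: with `Z = ∫e^{−U(Tξ+ψ)}dN(0,I)`, `g_v(ξ) = U′(Tξ+ψ)(e_v)`, `μ = Z⁻¹∫e g_v`,
`Z⁻¹∫e^{−U(Tξ+ψ)}(g_v(ξ) − μ)⁴ dN(0,I)(ξ) ≤ 5κ₂⁴γ_op²∕(1 − λγ_op)²`. [folklore] -/
theorem whitened_fourth_moment_le [Nonempty ι] (hΓop : (γop • (1 : Matrix ι ι ℝ) - A * Aᵀ).PosSemidef) (Y : Finset ι)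
    (hUd : ∀ φ : EuclideanSpace ℝ ι, HasFDerivAt U (U' φ) φ) (hU'd : ∀ φ : EuclideanSpace ℝ ι, HasFDerivAt U' (U'' φ) φ)
    (hU''c : Continuous U'') (hκ₀ : 0 ≤ κ₀) (hκ₁ : 0 ≤ κ₁) (ha : 0 ≤ a) (hτ : 0 < τ) (hδ : 0 < δ) (hθ0 : 0 < θ) (hθ1 : θ < 1)
    (hκθ : (2 * κ₀ * (1 + τ) + 4 * δ) * γop ≤ θ) (hstab : ∀ φ : EuclideanSpace ℝ ι, -(κ₀ * ∑ x ∈ Y, φ x ^ 2) ≤ U φ)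
    (hU'b : ∀ φ : EuclideanSpace ℝ ι, ‖U' φ‖ ≤ κ₁ * (a + ∑ x ∈ Y, φ x ^ 2)) (hU''b : ∀ φ : EuclideanSpace ℝ ι, ‖U'' φ‖ ≤ κ₂) (hlam : 0 ≤ lam)
    (hUsec : ∀ s : ℝ, 0 ≤ s → s ≤ 1 → ∀ a b : EuclideanSpace ℝ ι,
      U ((1 - s) • a + s • b) - lam / 2 * (s * (1 - s)) * ∑ i, (a i - b i) ^ 2 ≤ (1 - s) * U a + s * U b)
    (hρ : lam * γop < 1) (ψ : EuclideanSpace ℝ ι) (v : ι) :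
    (∫ ξ : EuclideanSpace ℝ κ, exp (-U (matrixCLM A ξ + ψ)) ∂(multivariateGaussian 0 (1 : Matrix κ κ ℝ)))⁻¹ *
        (∫ ξ : EuclideanSpace ℝ κ, exp (-U (matrixCLM A ξ + ψ)) * (U' (matrixCLM A ξ + ψ) (EuclideanSpace.single v (1 : ℝ)) -
          (∫ ξ : EuclideanSpace ℝ κ, exp (-U (matrixCLM A ξ + ψ)) ∂(multivariateGaussian 0 (1 : Matrix κ κ ℝ)))⁻¹ *
            (∫ ξ : EuclideanSpace ℝ κ, exp (-U (matrixCLM A ξ + ψ)) * U' (matrixCLM A ξ + ψ) (EuclideanSpace.single v (1 : ℝ))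
              ∂(multivariateGaussian 0 (1 : Matrix κ κ ℝ)))) ^ 4 ∂(multivariateGaussian 0 (1 : Matrix κ κ ℝ))) ≤
      5 * (κ₂ ^ 4 * γop ^ 2) / (1 - lam * γop) ^ 2 := by
  have hUc : Continuous U := continuous_iff_continuousAt.2 fun φ => (hUd φ).continuousAt
  have hU'c : Continuous U' := continuous_iff_continuousAt.2 fun φ => (hU'd φ).continuousAt
  have hγ := op_letter_nonneg hΓop
  have hκθ₀ : 2 * κ₀ * (1 + τ) * γop ≤ θ := SupEffectiveActionDerivative.mul_opBound_le_of_le (by positivity) (by linarith) hθ0.le hκθ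
  have hI := whitened_exp_integrable hΓop Y hUc.measurable hκ₀ hτ hθ1 hκθ₀ hstab ψ
  have hZ : 0 < ∫ ξ : EuclideanSpace ℝ κ, exp (-U (matrixCLM A ξ + ψ)) ∂(multivariateGaussian 0 (1 : Matrix κ κ ℝ)) := integral_exp_pos hI
  have hρ0 : 0 < 1 - lam * γop := sub_pos.2 hρ
  obtain ⟨hgd, hg'c, hg'b⟩ := whitened_obs_hasFDerivAt hΓop hU'd hU''c hU''b ψ v
  obtain ⟨k1, k2, k3, k4⟩ := whitened_obs_moments hΓop Y hUd hU'd hκ₀ hκ₁ ha hτ hδ hθ1 hκθ hstab hU'b ψ v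
  set μ : ℝ := (∫ ξ : EuclideanSpace ℝ κ, exp (-U (matrixCLM A ξ + ψ)) ∂(multivariateGaussian 0 (1 : Matrix κ κ ℝ)))⁻¹ *
      (∫ ξ : EuclideanSpace ℝ κ, exp (-U (matrixCLM A ξ + ψ)) * U' (matrixCLM A ξ + ψ) (EuclideanSpace.single v (1 : ℝ))
        ∂(multivariateGaussian 0 (1 : Matrix κ κ ℝ))) with hμ
  have hsh : Continuous fun ξ : EuclideanSpace ℝ κ => matrixCLM A ξ + ψ := (matrixCLM A).continuous.add continuous_const
  have hgc : Continuous fun ξ : EuclideanSpace ℝ κ => U' (matrixCLM A ξ + ψ) (EuclideanSpace.single v (1 : ℝ)) :=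
    (hU'c.comp hsh).clm_apply continuous_const
  have hEc : Continuous fun ξ : EuclideanSpace ℝ κ => exp (-U (matrixCLM A ξ + ψ)) := continuous_exp.comp ((hUc.comp hsh).neg)
  -- `e·g³` is integrable (from `e·|g|³`)
  have k3' : Integrable (fun ξ : EuclideanSpace ℝ κ => exp (-U (matrixCLM A ξ + ψ)) * U' (matrixCLM A ξ + ψ) (EuclideanSpace.single v (1 : ℝ)) ^ 3)
      (multivariateGaussian 0 (1 : Matrix κ κ ℝ)) :=
    k3.mono' ((hEc.mul (hgc.pow 3)).aestronglyMeasurable) (ae_of_all _ fun ξ => by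
      rw [Real.norm_eq_abs, abs_mul, abs_of_pos (exp_pos _), abs_pow])
  -- the centred observable `g₂ = (g − μ)²`
  have hg2 : ∀ ξ : EuclideanSpace ℝ κ, HasFDerivAt (fun ξ : EuclideanSpace ℝ κ => (U' (matrixCLM A ξ + ψ) (EuclideanSpace.single v (1 : ℝ)) - μ) ^ 2)
      ((2 * (U' (matrixCLM A ξ + ψ) (EuclideanSpace.single v (1 : ℝ)) - μ)) •
        ((U'' (matrixCLM A ξ + ψ)).flip (EuclideanSpace.single v (1 : ℝ))).comp (matrixCLM A)) ξ := fun ξ => by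
    have h := ((hgd ξ).sub_const μ).pow 2
    refine h.congr_fderiv ?_
    simp only [Nat.cast_ofNat, pow_one, Nat.add_one_sub_one, nsmul_eq_mul]
  have hg2'c : Continuous fun ξ : EuclideanSpace ℝ κ => (2 * (U' (matrixCLM A ξ + ψ) (EuclideanSpace.single v (1 : ℝ)) - μ)) •
      ((U'' (matrixCLM A ξ + ψ)).flip (EuclideanSpace.single v (1 : ℝ))).comp (matrixCLM A) := (continuous_const.mul (hgc.sub continuous_const)).smul hg'c
  -- its integrability letters
  have e2 : ∀ ξ : EuclideanSpace ℝ κ, exp (-U (matrixCLM A ξ + ψ)) * (U' (matrixCLM A ξ + ψ) (EuclideanSpace.single v (1 : ℝ)) - μ) ^ 2 =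
      exp (-U (matrixCLM A ξ + ψ)) * U' (matrixCLM A ξ + ψ) (EuclideanSpace.single v (1 : ℝ)) ^ 2 -
        2 * μ * (exp (-U (matrixCLM A ξ + ψ)) * U' (matrixCLM A ξ + ψ) (EuclideanSpace.single v (1 : ℝ))) + μ ^ 2 * exp (-U (matrixCLM A ξ + ψ)) := fun ξ => by ring
  have ig2 : Integrable (fun ξ : EuclideanSpace ℝ κ => exp (-U (matrixCLM A ξ + ψ)) * (U' (matrixCLM A ξ + ψ) (EuclideanSpace.single v (1 : ℝ)) - μ) ^ 2)
      (multivariateGaussian 0 (1 : Matrix κ κ ℝ)) := by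
    simp_rw [e2]; exact (k2.sub (k1.const_mul _)).add (hI.const_mul _)
  have e4 : ∀ ξ : EuclideanSpace ℝ κ, exp (-U (matrixCLM A ξ + ψ)) * ((U' (matrixCLM A ξ + ψ) (EuclideanSpace.single v (1 : ℝ)) - μ) ^ 2) ^ 2 =
      exp (-U (matrixCLM A ξ + ψ)) * U' (matrixCLM A ξ + ψ) (EuclideanSpace.single v (1 : ℝ)) ^ 4 -
        4 * μ * (exp (-U (matrixCLM A ξ + ψ)) * U' (matrixCLM A ξ + ψ) (EuclideanSpace.single v (1 : ℝ)) ^ 3) +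
        6 * μ ^ 2 * (exp (-U (matrixCLM A ξ + ψ)) * U' (matrixCLM A ξ + ψ) (EuclideanSpace.single v (1 : ℝ)) ^ 2) -
        4 * μ ^ 3 * (exp (-U (matrixCLM A ξ + ψ)) * U' (matrixCLM A ξ + ψ) (EuclideanSpace.single v (1 : ℝ))) + μ ^ 4 * exp (-U (matrixCLM A ξ + ψ)) :=
    fun ξ => by ring
  have ig4 : Integrable (fun ξ : EuclideanSpace ℝ κ => exp (-U (matrixCLM A ξ + ψ)) * ((U' (matrixCLM A ξ + ψ) (EuclideanSpace.single v (1 : ℝ)) - μ) ^ 2) ^ 2)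
      (multivariateGaussian 0 (1 : Matrix κ κ ℝ)) := by
    simp_rw [e4]; exact ((((k4.sub (k3'.const_mul _)).add (k2.const_mul _)).sub (k1.const_mul _)).add (hI.const_mul _))
  have igD : Integrable (fun ξ : EuclideanSpace ℝ κ => exp (-U (matrixCLM A ξ + ψ)) * ‖(2 * (U' (matrixCLM A ξ + ψ) (EuclideanSpace.single v (1 : ℝ)) - μ)) •
      ((U'' (matrixCLM A ξ + ψ)).flip (EuclideanSpace.single v (1 : ℝ))).comp (matrixCLM A)‖ ^ 2) (multivariateGaussian 0 (1 : Matrix κ κ ℝ)) := by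
    refine (ig2.const_mul (4 * (κ₂ * Real.sqrt γop) ^ 2)).mono' ((hEc.mul ((continuous_norm.comp hg2'c).pow 2)).aestronglyMeasurable)
      (ae_of_all _ fun ξ => ?_)
    rw [Real.norm_eq_abs, abs_of_nonneg (mul_nonneg (exp_pos _).le (sq_nonneg _)), norm_smul, mul_pow, Real.norm_eq_abs, abs_mul,
      abs_two, mul_pow, sq_abs]
    have h1 : ‖((U'' (matrixCLM A ξ + ψ)).flip (EuclideanSpace.single v (1 : ℝ))).comp (matrixCLM A)‖ ^ 2 ≤ (κ₂ * Real.sqrt γop) ^ 2 :=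
      pow_le_pow_left₀ (norm_nonneg _) (hg'b ξ) 2
    nlinarith [exp_pos (-U (matrixCLM A ξ + ψ)), sq_nonneg (U' (matrixCLM A ξ + ψ) (EuclideanSpace.single v (1 : ℝ)) - μ),
      mul_nonneg (exp_pos (-U (matrixCLM A ξ + ψ))).le (sq_nonneg (U' (matrixCLM A ξ + ψ) (EuclideanSpace.single v (1 : ℝ)) - μ))]
  -- Poincaré for `g₂` in the `ξ`-coordinates ((422) with `M = I`)
  have hP := tilted_poincare (M := (1 : Matrix κ κ ℝ)) (m := 1) (lam := lam * γop) (U := fun η : EuclideanSpace ℝ κ => U (matrixCLM A η + ψ))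
    (U' := fun η : EuclideanSpace ℝ κ => (U' (matrixCLM A η + ψ)).comp (matrixCLM A)) Matrix.PosDef.one one_floor (whitened_hasFDerivAt hUd A ψ)
    (by positivity) (fun s hs0 hs1 a b => whitened_secant hΓop hlam hUsec ψ s hs0 hs1 a b) hρ (0 : EuclideanSpace ℝ κ)
    (by simpa only [add_zero, inv_one] using hI) hg2 hg2'c (by simpa only [add_zero, inv_one] using ig2) (by simpa only [add_zero, inv_one] using ig4)
    (by simpa only [add_zero, inv_one] using igD)
  simp only [add_zero, inv_one] at hP
  -- `E g₂ = Var(g) ≤ κ₂²γ_op/(1−λγ_op)`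
  have hVar := whitened_variance_le hΓop Y hUd hU'd hU''c hκ₀ hκ₁ ha hτ hδ hθ0 hθ1 hκθ hstab hU'b hU''b hlam hUsec hρ ψ v
  have hEq : (∫ ξ : EuclideanSpace ℝ κ, exp (-U (matrixCLM A ξ + ψ)) ∂(multivariateGaussian 0 (1 : Matrix κ κ ℝ)))⁻¹ *
      (∫ ξ : EuclideanSpace ℝ κ, exp (-U (matrixCLM A ξ + ψ)) * (U' (matrixCLM A ξ + ψ) (EuclideanSpace.single v (1 : ℝ)) - μ) ^ 2
        ∂(multivariateGaussian 0 (1 : Matrix κ κ ℝ))) =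
      (∫ ξ : EuclideanSpace ℝ κ, exp (-U (matrixCLM A ξ + ψ)) ∂(multivariateGaussian 0 (1 : Matrix κ κ ℝ)))⁻¹ *
        (∫ ξ : EuclideanSpace ℝ κ, exp (-U (matrixCLM A ξ + ψ)) * U' (matrixCLM A ξ + ψ) (EuclideanSpace.single v (1 : ℝ)) ^ 2
          ∂(multivariateGaussian 0 (1 : Matrix κ κ ℝ))) - μ ^ 2 := by
    simp_rw [e2]
    have iB : Integrable (fun ξ : EuclideanSpace ℝ κ => exp (-U (matrixCLM A ξ + ψ)) * U' (matrixCLM A ξ + ψ) (EuclideanSpace.single v (1 : ℝ)) ^ 2 -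
        2 * μ * (exp (-U (matrixCLM A ξ + ψ)) * U' (matrixCLM A ξ + ψ) (EuclideanSpace.single v (1 : ℝ)))) (multivariateGaussian 0 (1 : Matrix κ κ ℝ)) :=
      k2.sub (k1.const_mul _)
    have iC : Integrable (fun ξ : EuclideanSpace ℝ κ => μ ^ 2 * exp (-U (matrixCLM A ξ + ψ))) (multivariateGaussian 0 (1 : Matrix κ κ ℝ)) := hI.const_mul _
    rw [integral_add iB iC, integral_sub k2 (k1.const_mul _), integral_const_mul, integral_const_mul]
    have hZne := hZ.ne'
    rw [hμ]
    field_simp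
    ring
  have hEg2 : (∫ ξ : EuclideanSpace ℝ κ, exp (-U (matrixCLM A ξ + ψ)) ∂(multivariateGaussian 0 (1 : Matrix κ κ ℝ)))⁻¹ *
      (∫ ξ : EuclideanSpace ℝ κ, exp (-U (matrixCLM A ξ + ψ)) * (U' (matrixCLM A ξ + ψ) (EuclideanSpace.single v (1 : ℝ)) - μ) ^ 2
        ∂(multivariateGaussian 0 (1 : Matrix κ κ ℝ))) ≤ κ₂ ^ 2 * γop / (1 - lam * γop) := by rw [hEq]; exact hVar
  have hEg2nn : 0 ≤ (∫ ξ : EuclideanSpace ℝ κ, exp (-U (matrixCLM A ξ + ψ)) ∂(multivariateGaussian 0 (1 : Matrix κ κ ℝ)))⁻¹ *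
      (∫ ξ : EuclideanSpace ℝ κ, exp (-U (matrixCLM A ξ + ψ)) * (U' (matrixCLM A ξ + ψ) (EuclideanSpace.single v (1 : ℝ)) - μ) ^ 2
        ∂(multivariateGaussian 0 (1 : Matrix κ κ ℝ))) :=
    mul_nonneg (inv_nonneg.2 hZ.le) (integral_nonneg fun ξ => mul_nonneg (exp_pos _).le (sq_nonneg _))
  -- the right side of Poincaré: `Z⁻¹∫e‖g₂′‖² ≤ 4κ₂²γ_op·Z⁻¹∫e(g−μ)²`
  have hR : (∫ ξ : EuclideanSpace ℝ κ, exp (-U (matrixCLM A ξ + ψ)) ∂(multivariateGaussian 0 (1 : Matrix κ κ ℝ)))⁻¹ *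
      (∫ ξ : EuclideanSpace ℝ κ, exp (-U (matrixCLM A ξ + ψ)) * ‖(2 * (U' (matrixCLM A ξ + ψ) (EuclideanSpace.single v (1 : ℝ)) - μ)) •
        ((U'' (matrixCLM A ξ + ψ)).flip (EuclideanSpace.single v (1 : ℝ))).comp (matrixCLM A)‖ ^ 2 ∂(multivariateGaussian 0 (1 : Matrix κ κ ℝ))) ≤
      4 * (κ₂ * Real.sqrt γop) ^ 2 * ((∫ ξ : EuclideanSpace ℝ κ, exp (-U (matrixCLM A ξ + ψ)) ∂(multivariateGaussian 0 (1 : Matrix κ κ ℝ)))⁻¹ *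
        (∫ ξ : EuclideanSpace ℝ κ, exp (-U (matrixCLM A ξ + ψ)) * (U' (matrixCLM A ξ + ψ) (EuclideanSpace.single v (1 : ℝ)) - μ) ^ 2
          ∂(multivariateGaussian 0 (1 : Matrix κ κ ℝ)))) := by
    have h1 : (∫ ξ : EuclideanSpace ℝ κ, exp (-U (matrixCLM A ξ + ψ)) * ‖(2 * (U' (matrixCLM A ξ + ψ) (EuclideanSpace.single v (1 : ℝ)) - μ)) •
        ((U'' (matrixCLM A ξ + ψ)).flip (EuclideanSpace.single v (1 : ℝ))).comp (matrixCLM A)‖ ^ 2 ∂(multivariateGaussian 0 (1 : Matrix κ κ ℝ))) ≤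
        ∫ ξ : EuclideanSpace ℝ κ, 4 * (κ₂ * Real.sqrt γop) ^ 2 * (exp (-U (matrixCLM A ξ + ψ)) * (U' (matrixCLM A ξ + ψ) (EuclideanSpace.single v (1 : ℝ)) - μ) ^ 2)
          ∂(multivariateGaussian 0 (1 : Matrix κ κ ℝ)) :=
      integral_mono igD (ig2.const_mul _) fun ξ => by
        dsimp only
        rw [norm_smul, mul_pow, Real.norm_eq_abs, abs_mul, abs_two, mul_pow, sq_abs]
        have h1 : ‖((U'' (matrixCLM A ξ + ψ)).flip (EuclideanSpace.single v (1 : ℝ))).comp (matrixCLM A)‖ ^ 2 ≤ (κ₂ * Real.sqrt γop) ^ 2 :=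
          pow_le_pow_left₀ (norm_nonneg _) (hg'b ξ) 2
        nlinarith [exp_pos (-U (matrixCLM A ξ + ψ)), sq_nonneg (U' (matrixCLM A ξ + ψ) (EuclideanSpace.single v (1 : ℝ)) - μ),
          mul_nonneg (exp_pos (-U (matrixCLM A ξ + ψ))).le (sq_nonneg (U' (matrixCLM A ξ + ψ) (EuclideanSpace.single v (1 : ℝ)) - μ))]
    rw [integral_const_mul] at h1
    have := mul_le_mul_of_nonneg_left h1 (inv_nonneg.2 hZ.le)
    linarith [this]
  -- assemble
  have epow : ∀ ξ : EuclideanSpace ℝ κ, exp (-U (matrixCLM A ξ + ψ)) * (U' (matrixCLM A ξ + ψ) (EuclideanSpace.single v (1 : ℝ)) - μ) ^ 4 =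
      exp (-U (matrixCLM A ξ + ψ)) * ((U' (matrixCLM A ξ + ψ) (EuclideanSpace.single v (1 : ℝ)) - μ) ^ 2) ^ 2 := fun ξ => by ring
  simp_rw [epow]
  set E2 : ℝ := (∫ ξ : EuclideanSpace ℝ κ, exp (-U (matrixCLM A ξ + ψ)) ∂(multivariateGaussian 0 (1 : Matrix κ κ ℝ)))⁻¹ *
      (∫ ξ : EuclideanSpace ℝ κ, exp (-U (matrixCLM A ξ + ψ)) * (U' (matrixCLM A ξ + ψ) (EuclideanSpace.single v (1 : ℝ)) - μ) ^ 2
        ∂(multivariateGaussian 0 (1 : Matrix κ κ ℝ))) with hE2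
  set E4 : ℝ := (∫ ξ : EuclideanSpace ℝ κ, exp (-U (matrixCLM A ξ + ψ)) ∂(multivariateGaussian 0 (1 : Matrix κ κ ℝ)))⁻¹ *
      (∫ ξ : EuclideanSpace ℝ κ, exp (-U (matrixCLM A ξ + ψ)) * ((U' (matrixCLM A ξ + ψ) (EuclideanSpace.single v (1 : ℝ)) - μ) ^ 2) ^ 2
        ∂(multivariateGaussian 0 (1 : Matrix κ κ ℝ))) with hE4
  have hL2 : (κ₂ * Real.sqrt γop) ^ 2 = κ₂ ^ 2 * γop := by rw [mul_pow, Real.sq_sqrt hγ]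
  have hP' : E4 - E2 ^ 2 ≤ (1 - lam * γop)⁻¹ * (4 * (κ₂ ^ 2 * γop) * E2) := by
    have h := hP.trans (mul_le_mul_of_nonneg_left hR (inv_nonneg.2 hρ0.le))
    rw [hL2] at h
    exact h
  have hb2 : E2 ≤ κ₂ ^ 2 * γop / (1 - lam * γop) := hEg2
  have hE2sq : E2 ^ 2 ≤ (κ₂ ^ 2 * γop / (1 - lam * γop)) ^ 2 := pow_le_pow_left₀ hEg2nn hb2 2
  have h4 : (1 - lam * γop)⁻¹ * (4 * (κ₂ ^ 2 * γop) * E2) ≤ 4 * (κ₂ ^ 4 * γop ^ 2) / (1 - lam * γop) ^ 2 := by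
    rw [show 4 * (κ₂ ^ 4 * γop ^ 2) / (1 - lam * γop) ^ 2 = (1 - lam * γop)⁻¹ * (4 * (κ₂ ^ 2 * γop) * (κ₂ ^ 2 * γop / (1 - lam * γop))) from by
      field_simp]
    exact mul_le_mul_of_nonneg_left (mul_le_mul_of_nonneg_left hb2 (by positivity)) (inv_nonneg.2 hρ0.le)
  have h5 : (κ₂ ^ 2 * γop / (1 - lam * γop)) ^ 2 = κ₂ ^ 4 * γop ^ 2 / (1 - lam * γop) ^ 2 := by field_simp
  rw [h5] at hE2sq
  have : E4 ≤ 4 * (κ₂ ^ 4 * γop ^ 2) / (1 - lam * γop) ^ 2 + κ₂ ^ 4 * γop ^ 2 / (1 - lam * γop) ^ 2 := by linarith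
  calc E4 ≤ 4 * (κ₂ ^ 4 * γop ^ 2) / (1 - lam * γop) ^ 2 + κ₂ ^ 4 * γop ^ 2 / (1 - lam * γop) ^ 2 := this
    _ = 5 * (κ₂ ^ 4 * γop ^ 2) / (1 - lam * γop) ^ 2 := by ring

/-! ## §2. (461)'s Gibbs format on `ℝ^κ` -/

/-- **`(F_v − c)⁴ ∈ L¹(ν)`** for every constant `c`, `F_v(z) = U′(T toLp z + ψ)(e_v)`, `ν ∝ e^{−V}dz`, `V(z) = ½z·z + U(T toLp z + ψ)`. [folklore] -/
theorem whitened_fourth_power_integrable (hΓop : (γop • (1 : Matrix ι ι ℝ) - A * Aᵀ).PosSemidef) (Y : Finset ι)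
    (hUd : ∀ φ : EuclideanSpace ℝ ι, HasFDerivAt U (U' φ) φ) (hU'd : ∀ φ : EuclideanSpace ℝ ι, HasFDerivAt U' (U'' φ) φ)
    (hκ₀ : 0 ≤ κ₀) (hκ₁ : 0 ≤ κ₁) (ha : 0 ≤ a) (hτ : 0 < τ) (hδ : 0 < δ) (hθ0 : 0 < θ) (hθ1 : θ < 1) (hκθ : (2 * κ₀ * (1 + τ) + 4 * δ) * γop ≤ θ)
    (hstab : ∀ φ : EuclideanSpace ℝ ι, -(κ₀ * ∑ x ∈ Y, φ x ^ 2) ≤ U φ) (hU'b : ∀ φ : EuclideanSpace ℝ ι, ‖U' φ‖ ≤ κ₁ * (a + ∑ x ∈ Y, φ x ^ 2))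
    (ψ : EuclideanSpace ℝ ι) (v : ι) (c : ℝ) :
    Integrable (fun z : κ → ℝ => (U' (matrixCLM A (WithLp.toLp 2 z) + ψ) (EuclideanSpace.single v (1 : ℝ)) - c) ^ 4)
      ((volume : Measure (κ → ℝ)).tilted fun z => -(1 / 2 * (z ⬝ᵥ z) + U (matrixCLM A (WithLp.toLp 2 z) + ψ))) := by
  have hUc : Continuous U := continuous_iff_continuousAt.2 fun φ => (hUd φ).continuousAt
  have hU'c : Continuous U' := continuous_iff_continuousAt.2 fun φ => (hU'd φ).continuousAt
  have hκθ₀ : 2 * κ₀ * (1 + τ) * γop ≤ θ := SupEffectiveActionDerivative.mul_opBound_le_of_le (by positivity) (by linarith) hθ0.le hκθ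
  have hI := whitened_exp_integrable hΓop Y hUc.measurable hκ₀ hτ hθ1 hκθ₀ hstab ψ
  obtain ⟨k1, k2, k3, k4⟩ := whitened_obs_moments hΓop Y hUd hU'd hκ₀ hκ₁ ha hτ hδ hθ1 hκθ hstab hU'b ψ v
  have hsh : Continuous fun ξ : EuclideanSpace ℝ κ => matrixCLM A ξ + ψ := (matrixCLM A).continuous.add continuous_const
  have hgc : Continuous fun ξ : EuclideanSpace ℝ κ => U' (matrixCLM A ξ + ψ) (EuclideanSpace.single v (1 : ℝ)) :=
    (hU'c.comp hsh).clm_apply continuous_const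
  have hEc : Continuous fun ξ : EuclideanSpace ℝ κ => exp (-U (matrixCLM A ξ + ψ)) := continuous_exp.comp ((hUc.comp hsh).neg)
  have k3' : Integrable (fun ξ : EuclideanSpace ℝ κ => exp (-U (matrixCLM A ξ + ψ)) * U' (matrixCLM A ξ + ψ) (EuclideanSpace.single v (1 : ℝ)) ^ 3)
      (multivariateGaussian 0 (1 : Matrix κ κ ℝ)) :=
    k3.mono' ((hEc.mul (hgc.pow 3)).aestronglyMeasurable) (ae_of_all _ fun ξ => by
      rw [Real.norm_eq_abs, abs_mul, abs_of_pos (exp_pos _), abs_pow])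
  -- `e·(g − c)⁴` is integrable under `N(0,I)`
  have e4 : ∀ ξ : EuclideanSpace ℝ κ, exp (-U (matrixCLM A ξ + ψ)) * (U' (matrixCLM A ξ + ψ) (EuclideanSpace.single v (1 : ℝ)) - c) ^ 4 =
      exp (-U (matrixCLM A ξ + ψ)) * U' (matrixCLM A ξ + ψ) (EuclideanSpace.single v (1 : ℝ)) ^ 4 -
        4 * c * (exp (-U (matrixCLM A ξ + ψ)) * U' (matrixCLM A ξ + ψ) (EuclideanSpace.single v (1 : ℝ)) ^ 3) +
        6 * c ^ 2 * (exp (-U (matrixCLM A ξ + ψ)) * U' (matrixCLM A ξ + ψ) (EuclideanSpace.single v (1 : ℝ)) ^ 2) -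
        4 * c ^ 3 * (exp (-U (matrixCLM A ξ + ψ)) * U' (matrixCLM A ξ + ψ) (EuclideanSpace.single v (1 : ℝ))) + c ^ 4 * exp (-U (matrixCLM A ξ + ψ)) :=
    fun ξ => by ring
  have ig4 : Integrable (fun ξ : EuclideanSpace ℝ κ => exp (-U (matrixCLM A ξ + ψ)) * (U' (matrixCLM A ξ + ψ) (EuclideanSpace.single v (1 : ℝ)) - c) ^ 4)
      (multivariateGaussian 0 (1 : Matrix κ κ ℝ)) := by
    simp_rw [e4]; exact ((((k4.sub (k3'.const_mul _)).add (k2.const_mul _)).sub (k1.const_mul _)).add (hI.const_mul _))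
  -- transfer to Lebesgue and then to the tilted law
  have hL := whitened_integrable_lebesgue A ψ (k := fun ξ : EuclideanSpace ℝ κ => (U' (matrixCLM A ξ + ψ) (EuclideanSpace.single v (1 : ℝ)) - c) ^ 4) ig4
  have hV0 : Integrable (fun z : κ → ℝ => exp (-(1 / 2 * (z ⬝ᵥ z) + U (matrixCLM A (WithLp.toLp 2 z) + ψ)))) := by
    have h := whitened_integrable_lebesgue A ψ (k := fun _ => (1 : ℝ)) (by simpa only [mul_one] using hI)
    simpa only [one_mul] using h
  rw [integrable_tilted_iff hV0]
  refine hL.congr (ae_of_all _ fun z => ?_)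
  simp only [smul_eq_mul]
  ring

/-- **THE FOURTH CENTRED MOMENT IN (461)'s FORMAT**: `∫(F_v − E_νF_v)⁴dν ≤ 5κ₂⁴γ_op²∕(1 − λγ_op)²` for the Gibbs law `ν ∝ e^{−V}dz` on `ℝ^κ`,
`V(z) = ½z·z + U(T toLp z + ψ)`, `F_v(z) = U′(T toLp z + ψ)(e_v)`. [folklore] -/
theorem whitened_fourth_moment_gibbs [Nonempty ι] (hΓop : (γop • (1 : Matrix ι ι ℝ) - A * Aᵀ).PosSemidef) (Y : Finset ι)
    (hUd : ∀ φ : EuclideanSpace ℝ ι, HasFDerivAt U (U' φ) φ) (hU'd : ∀ φ : EuclideanSpace ℝ ι, HasFDerivAt U' (U'' φ) φ)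
    (hU''c : Continuous U'') (hκ₀ : 0 ≤ κ₀) (hκ₁ : 0 ≤ κ₁) (ha : 0 ≤ a) (hτ : 0 < τ) (hδ : 0 < δ) (hθ0 : 0 < θ) (hθ1 : θ < 1)
    (hκθ : (2 * κ₀ * (1 + τ) + 4 * δ) * γop ≤ θ) (hstab : ∀ φ : EuclideanSpace ℝ ι, -(κ₀ * ∑ x ∈ Y, φ x ^ 2) ≤ U φ)
    (hU'b : ∀ φ : EuclideanSpace ℝ ι, ‖U' φ‖ ≤ κ₁ * (a + ∑ x ∈ Y, φ x ^ 2)) (hU''b : ∀ φ : EuclideanSpace ℝ ι, ‖U'' φ‖ ≤ κ₂) (hlam : 0 ≤ lam)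
    (hUsec : ∀ s : ℝ, 0 ≤ s → s ≤ 1 → ∀ a b : EuclideanSpace ℝ ι,
      U ((1 - s) • a + s • b) - lam / 2 * (s * (1 - s)) * ∑ i, (a i - b i) ^ 2 ≤ (1 - s) * U a + s * U b)
    (hρ : lam * γop < 1) (ψ : EuclideanSpace ℝ ι) (v : ι) :
    ∫ z, (U' (matrixCLM A (WithLp.toLp 2 z) + ψ) (EuclideanSpace.single v (1 : ℝ)) -
          ∫ z', U' (matrixCLM A (WithLp.toLp 2 z') + ψ) (EuclideanSpace.single v (1 : ℝ))
            ∂((volume : Measure (κ → ℝ)).tilted fun z => -(1 / 2 * (z ⬝ᵥ z) + U (matrixCLM A (WithLp.toLp 2 z) + ψ)))) ^ 4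
        ∂((volume : Measure (κ → ℝ)).tilted fun z => -(1 / 2 * (z ⬝ᵥ z) + U (matrixCLM A (WithLp.toLp 2 z) + ψ))) ≤
      5 * (κ₂ ^ 4 * γop ^ 2) / (1 - lam * γop) ^ 2 := by
  have h := whitened_fourth_moment_le hΓop Y hUd hU'd hU''c hκ₀ hκ₁ ha hτ hδ hθ0 hθ1 hκθ hstab hU'b hU''b hlam hUsec hρ ψ v
  rw [whitened_tilted_eq_gauss A ψ, whitened_tilted_eq_gauss A ψ]
  simp only [WithLp.toLp_ofLp]
  rw [div_eq_inv_mul, div_eq_inv_mul]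
  exact h

end Summit.QuantumFields.BalabanUV.T4Continuum.NE7b.SupWhitenedFourthMoment

end
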